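import Literature.Analysis.FluidPDE.MildSolutionProofs
import Literature.Analysis.FluidPDE.FlatSwirlGauge
import Summits.NavierStokesRegularity.NavierStokesRegularity.Theorems.AxisymmetricExtremalityAxisymmetricKatoGlobalStubSereginLogSwirlOriginParabolicNullLines
import Mathlib.Analysis.Calculus.Deriv.Shift
import HarnessLib

/-!
# Seregin 2020, Lemma 2.2 (after Nazarov–Uraltseva 2012): parabolic bumps at scale `r` and
# finite parabolic covers of the singular set

Helper toward the stub `stub_seregin2020TypeII` of the crux `AxisymmetricKatoGlobal` (= the named
fact `Literature.Analysis.FluidPDE.Seregin2020_axisymmetricSingularPoint_typeII`, G. Seregin,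
Anal. Math. Phys. 10 (2020) Paper 46 = arXiv:2006.04140, Thm 2.1), reduced in the tree to the
corrected Lemma 2.2 (`hWH′`; Nazarov–Uraltseva 2012, Lemma 4.2 for the class 𝒱). Two of its
steps use smooth space–time cut-offs adapted to the PARABOLIC scaling: the test function of
N–U's (4.6) (`η ≡ 1` on an inner cylinder, `|∂ₜη| + |Dη|² + |Δη| ≤ C/R²`), and the excision of
the closed `𝒫¹`-null singular set `S` of the class 𝒱 (Seregin 2020, class 𝒱 (i)), covered by
finitely many centred parabolic cylinders `Q*_{rᵢ}(zᵢ)` with `∑ rᵢ` small. This file provides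
both from the tree's standard cut-off `cutoff R` (`WholeSpaceIBP`/`MildSolutionProofs`: `= 1` on
`‖x‖ ≤ R`, `= 0` for `‖x‖ ≥ 2R`, `‖D‖ ≤ C/R`, `|Δ| ≤ C/R²`), used on `ℝ³` in space and on `ℝ`
(radius `r²`) in time:

* `parabolicBump_props` — for `ψ(t, x) = cutoff (r²) (t - t₀) · cutoff r (x - x₀)`, `r > 0`:
  smooth, values in `[0, 1]`, `= 1` on `{|t - t₀| ≤ r², ‖x - x₀‖ ≤ r} ⊇ Q*_r(z₀)`, `= 0` unless
  `|t - t₀| < 2r²` and `‖x - x₀‖ < 2r`;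
* `exists_parabolicBump_deriv_bounds` — an absolute `A` with `|∂ₜψ| ≤ A/r²`, `‖D_xψ‖ ≤ A/r`,
  `|Δ_xψ| ≤ A/r²` for all centres, radii `r > 0` and points;
* `exists_finite_parabolic_cover` — a compact subset `K` of a `𝒫¹`-null set is covered, for
  every `ε > 0`, by finitely many centred parabolic cylinders with radii in `]0, 1[` and
  `∑ rᵢ < ε` (from the tree's `exists_cover_of_isParabolicNull`).

## References

* G. Seregin, Anal. Math. Phys. 10 (2020), Paper 46 = arXiv:2006.04140, Lemma 2.2, class 𝒱 (i)
  (arXiv p. 8). [Seregin2020]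
* A. I. Nazarov, N. N. Uraltseva, St. Petersburg Math. J. 23 (2012) 93–115 = arXiv:1011.1888,
  proof of Lemma 4.2, the test function of (4.6). [NazarovUraltseva2012]
* L. Caffarelli, R. Kohn, L. Nirenberg, Comm. Pure Appl. Math. 35 (1982), (2.6) (parabolic
  Hausdorff measure `𝒫¹`). [CaffarelliKohnNirenberg1982]
-/

-- the problem directory repeats the summit name (D-0017); core's `dupNamespace` linter fires
set_option linter.dupNamespace false

noncomputable section

open MeasureTheory Set Function Filter Topology TopologicalSpace Metric
open scoped NNReal ENNReal InnerProductSpace Laplacian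

namespace Summit.NavierStokesRegularity.NavierStokesRegularity.Theorems.AxisymmetricKatoGlobal.EulerScaling

open Literature.Analysis.FluidPDE

/-! ### The parabolic bump `ψ(t, x) = cutoff (r²) (t - t₀) · cutoff r (x - x₀)` -/

/-- **Parabolic bumps: algebraic properties.** For `r > 0` and
`ψ(t, x) = cutoff (r²) (t - t₀) · cutoff r (x - x₀)`: `ψ` is smooth on `ℝ × ℝ³`, `0 ≤ ψ ≤ 1`,
`ψ = 1` where `|t - t₀| ≤ r²` and `‖x - x₀‖ ≤ r`, and `ψ(t, x) ≠ 0` forces `|t - t₀| < 2r²` and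
`‖x - x₀‖ < 2r`. [folklore] -/
theorem parabolicBump_props {r t₀ : ℝ} {x₀ : EuclideanSpace ℝ (Fin 3)} (hr : 0 < r)
    {ψ : ℝ → EuclideanSpace ℝ (Fin 3) → ℝ}
    (hψ : ∀ t x, ψ t x = cutoff (r ^ 2) (t - t₀) * cutoff r (x - x₀)) :
    ContDiff ℝ (⊤ : ℕ∞) (uncurry ψ) ∧ (∀ t x, 0 ≤ ψ t x) ∧ (∀ t x, ψ t x ≤ 1) ∧
    (∀ t x, |t - t₀| ≤ r ^ 2 → ‖x - x₀‖ ≤ r → ψ t x = 1) ∧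
    (∀ t x, ψ t x ≠ 0 → |t - t₀| < 2 * r ^ 2 ∧ ‖x - x₀‖ < 2 * r) := by
  have hr2 : 0 < r ^ 2 := by positivity
  have hfun : uncurry ψ = fun z : ℝ × EuclideanSpace ℝ (Fin 3) => cutoff (r ^ 2) (z.1 - t₀) * cutoff r (z.2 - x₀) :=
    funext fun z => hψ z.1 z.2
  refine ⟨?_, fun t x => ?_, fun t x => ?_, fun t x ht hx => ?_, fun t x h => ?_⟩
  · rw [hfun]
    exact ((contDiff_cutoff (r ^ 2)).comp (contDiff_fst.sub contDiff_const)).mul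
      ((contDiff_cutoff r).comp (contDiff_snd.sub contDiff_const))
  · rw [hψ]; exact mul_nonneg (cutoff_nonneg _ _) (cutoff_nonneg _ _)
  · rw [hψ]
    exact mul_le_one₀ (cutoff_le_one _ _) (cutoff_nonneg _ _) (cutoff_le_one _ _)
  · rw [hψ, cutoff_eq_one hr2 (by rwa [Real.norm_eq_abs]), cutoff_eq_one hr hx, mul_one]
  · rw [hψ] at h
    have h1 : cutoff (r ^ 2) (t - t₀) ≠ 0 := left_ne_zero_of_mul h
    have h2 : cutoff r (x - x₀) ≠ 0 := right_ne_zero_of_mul h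
    constructor
    · by_contra hc
      exact h1 (cutoff_eq_zero hr2 (by rw [Real.norm_eq_abs]; linarith))
    · by_contra hc
      exact h2 (cutoff_eq_zero hr (by linarith))

/-- **Parabolic bumps: scale-invariant derivative bounds.** There is an absolute `A ≥ 0` such that
for every `r > 0`, centre `(t₀, x₀)` and `ψ(t, x) = cutoff (r²) (t - t₀) · cutoff r (x - x₀)`:
`|∂ₜψ(t,x)| ≤ A/r²`, `‖D_x ψ(t,·)(x)‖ ≤ A/r` and `|Δ_x ψ(t,·)(x)| ≤ A/r²` (chain rule through
the parabolic dilation; `‖D cutoff R‖ ≤ C/R`, `|Δ cutoff R| ≤ C/R²`). [folklore] -/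
theorem exists_parabolicBump_deriv_bounds : ∃ A : ℝ, 0 ≤ A ∧
    ∀ (r t₀ : ℝ) (x₀ : EuclideanSpace ℝ (Fin 3)), 0 < r → ∀ (ψ : ℝ → EuclideanSpace ℝ (Fin 3) → ℝ),
    (∀ t x, ψ t x = cutoff (r ^ 2) (t - t₀) * cutoff r (x - x₀)) →
    ∀ (t : ℝ) (x : EuclideanSpace ℝ (Fin 3)),
      |deriv (fun s => ψ s x) t| ≤ A / r ^ 2 ∧ ‖fderiv ℝ (ψ t) x‖ ≤ A / r ∧
      |(Δ (ψ t)) x| ≤ A / r ^ 2 := by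
  obtain ⟨Ct, hCt0, hCt⟩ := exists_norm_fderiv_cutoff_le (E := ℝ)
  obtain ⟨C₁, hC₁0, hC₁⟩ := exists_norm_fderiv_cutoff_le (E := EuclideanSpace ℝ (Fin 3))
  obtain ⟨C₂, hC₂0, hC₂⟩ := exists_abs_laplacian_cutoff_le (E := EuclideanSpace ℝ (Fin 3))
  refine ⟨max Ct (max C₁ C₂), le_max_of_le_left hCt0, fun r t₀ x₀ hr ψ hψ t x => ?_⟩
  have hr2 : 0 < r ^ 2 := by positivity
  have hψt : (fun s => ψ s x) = fun s => cutoff (r ^ 2) (s - t₀) * cutoff r (x - x₀) := funext fun s => hψ s x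
  have hψx : ψ t = fun y => cutoff (r ^ 2) (t - t₀) * cutoff r (y - x₀) := funext fun y => hψ t y
  have ha1 : |cutoff (r ^ 2) (t - t₀)| ≤ 1 := abs_cutoff_le_one _ _
  have hb1 : |cutoff r (x - x₀)| ≤ 1 := abs_cutoff_le_one _ _
  refine ⟨?_, ?_, ?_⟩
  · -- time derivative
    rw [hψt, deriv_mul_const_field, deriv_comp_sub_const, abs_mul]
    have h1 : |deriv (cutoff (r ^ 2)) (t - t₀)| ≤ Ct / r ^ 2 := by
      rw [← Real.norm_eq_abs, norm_deriv_eq_norm_fderiv]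
      exact hCt (r ^ 2) hr2 (t - t₀)
    calc |deriv (cutoff (r ^ 2)) (t - t₀)| * |cutoff r (x - x₀)| ≤ Ct / r ^ 2 * 1 :=
          mul_le_mul h1 hb1 (abs_nonneg _) (div_nonneg hCt0 hr2.le)
      _ ≤ max Ct (max C₁ C₂) / r ^ 2 := by
          rw [mul_one]; exact div_le_div_of_nonneg_right (le_max_left _ _) hr2.le
  · -- spatial gradient
    rw [hψx]
    have hd : DifferentiableAt ℝ (fun y : EuclideanSpace ℝ (Fin 3) => cutoff r (y - x₀)) x :=
      ((contDiff_cutoff (n := 1) r).differentiable one_ne_zero).differentiableAt.comp x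
        (differentiableAt_id.sub_const x₀)
    rw [fderiv_const_mul hd (cutoff (r ^ 2) (t - t₀))]
    have e : fderiv ℝ (fun y : EuclideanSpace ℝ (Fin 3) => cutoff r (y - x₀)) x = fderiv ℝ (cutoff r) (x - x₀) := by
      have := fderiv_comp_add_right (𝕜 := ℝ) (f := cutoff (E := EuclideanSpace ℝ (Fin 3)) r) (x := x) (-x₀)
      simpa only [sub_eq_add_neg] using this
    rw [e, norm_smul, Real.norm_eq_abs]
    calc |cutoff (r ^ 2) (t - t₀)| * ‖fderiv ℝ (cutoff r) (x - x₀)‖ ≤ 1 * (C₁ / r) :=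
          mul_le_mul ha1 (hC₁ r hr _) (norm_nonneg _) zero_le_one
      _ ≤ max Ct (max C₁ C₂) / r := by
          rw [one_mul]
          exact div_le_div_of_nonneg_right ((le_max_left _ _).trans (le_max_right _ _)) hr.le
  · -- spatial Laplacian
    rw [hψx]
    have hc2 : ContDiff ℝ 2 (fun y : EuclideanSpace ℝ (Fin 3) => cutoff r (y - x₀)) :=
      (contDiff_cutoff r).comp (contDiff_id.sub contDiff_const)
    have e1 : (fun y : EuclideanSpace ℝ (Fin 3) => cutoff (r ^ 2) (t - t₀) * cutoff r (y - x₀)) =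
        cutoff (r ^ 2) (t - t₀) • fun y : EuclideanSpace ℝ (Fin 3) => cutoff r (y - x₀) := by
      funext y; simp [smul_eq_mul]
    rw [e1, InnerProductSpace.laplacian_smul _ hc2.contDiffAt, smul_eq_mul, abs_mul]
    have e2 : (Δ (fun y : EuclideanSpace ℝ (Fin 3) => cutoff r (y - x₀))) x = (Δ (cutoff (E := EuclideanSpace ℝ (Fin 3)) r)) (x - x₀) := by
      have := laplacian_comp_add_const (cutoff (E := EuclideanSpace ℝ (Fin 3)) r) (-x₀) x
      simpa only [sub_eq_add_neg] using this
    rw [e2]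
    calc |cutoff (r ^ 2) (t - t₀)| * |(Δ (cutoff (E := EuclideanSpace ℝ (Fin 3)) r)) (x - x₀)| ≤ 1 * (C₂ / r ^ 2) :=
          mul_le_mul ha1 (hC₂ r hr _) (abs_nonneg _) zero_le_one
      _ ≤ max Ct (max C₁ C₂) / r ^ 2 := by
          rw [one_mul]
          exact div_le_div_of_nonneg_right ((le_max_right _ _).trans (le_max_right _ _)) hr2.le

/-! ### Finite parabolic covers of compact `𝒫¹`-null sets -/

/-- **Finite cheap covers.** If `S` is `𝒫¹`-null and `K ⊆ S` is compact, then for every `ε > 0`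
there are finitely many centred parabolic cylinders `Q*_{rᵢ}(zᵢ)`, `0 < rᵢ < 1`, covering `K`
with `∑ rᵢ ≤ ε` (countable cover `exists_cover_of_isParabolicNull`, drop the empty cylinders of
radius `0`, extract a finite subcover). [cite: CaffarelliKohnNirenberg1982, (2.6)] -/
theorem exists_finite_parabolic_cover {S K : Set (ℝ × EuclideanSpace ℝ (Fin 3))} (hS : IsParabolicNull 1 S)
    (hK : IsCompact K) (hKS : K ⊆ S) {ε : ℝ} (hε : 0 < ε) :
    ∃ (s : Finset ℕ) (z : ℕ → ℝ × EuclideanSpace ℝ (Fin 3)) (r : ℕ → ℝ),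
      (∀ i ∈ s, 0 < r i ∧ r i < 1) ∧ K ⊆ ⋃ i ∈ s, parabolicCylinderCentered (r i) (z i) ∧
      ∑ i ∈ s, r i ≤ ε := by
  obtain ⟨z, r, hr, hcov, hsum⟩ := exists_cover_of_isParabolicNull hS (η := ENNReal.ofReal ε)
    (ENNReal.ofReal_pos.2 hε)
  -- finite subcover by the cylinders of positive radius (radius-`0` cylinders are empty)
  have hcovK : K ⊆ ⋃ i ∈ {i : ℕ | 0 < r i}, parabolicCylinderCentered (r i) (z i) := by
    intro w hw
    obtain ⟨i, hi⟩ := mem_iUnion.1 (hcov (hKS hw))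
    have hri : 0 < r i := by
      rw [mem_parabolicCylinderCentered] at hi
      exact lt_of_le_of_lt dist_nonneg hi.2
    exact mem_iUnion₂.2 ⟨i, hri, hi⟩
  obtain ⟨s, hs, hsfin, hsub⟩ := hK.elim_finite_subcover_image
    (fun i _ => isOpen_parabolicCylinderCentered (r i) (z i)) hcovK
  refine ⟨hsfin.toFinset, z, r, fun i hi => ⟨hs (hsfin.mem_toFinset.1 hi), (hr i).2⟩, ?_, ?_⟩
  · intro w hw
    obtain ⟨i, hi, hiw⟩ := mem_iUnion₂.1 (hsub hw)
    exact mem_iUnion₂.2 ⟨i, hsfin.mem_toFinset.2 hi, hiw⟩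
  · -- the finite sum is bounded by the `tsum`, which is `< ε`
    have h1 : ∑ i ∈ hsfin.toFinset, ENNReal.ofReal (r i) ≤ ∑' i, ENNReal.ofReal (r i) :=
      ENNReal.sum_le_tsum _
    have h2 : ∑ i ∈ hsfin.toFinset, ENNReal.ofReal (r i) ≤ ENNReal.ofReal ε := h1.trans hsum.le
    rw [← ENNReal.ofReal_sum_of_nonneg (fun i _ => (hr i).1)] at h2
    exact (ENNReal.ofReal_le_ofReal_iff hε.le).1 h2

end Summit.NavierStokesRegularity.NavierStokesRegularity.Theorems.AxisymmetricKatoGlobal.EulerScaling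

end
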